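import Literature.NumberTheory.EllipticCurves.QuadOrderPicardCoprimeCyclic
import Mathlib.FieldTheory.Finite.Basic
import HarnessLib

/-!
# Frobenius at an inert prime is complex conjugation on `𝓞_K/ℓ𝓞_K`, and the kernel of
# `Pic(𝒪_{cℓ}) → Pic(𝒪_c)` has exponent dividing `ℓ + 1` — with NO hypothesis on units
# (Gross 1991 §3: `G_ℓ ≃ 𝔽_λ^×/𝔽_ℓ^×`, `Frob_ℓ = τ` on `𝔽_λ`; Cox (7.25)–(7.27))

Topic `NumberTheory/EllipticCurves` (sequel of `QuadOrderPicardCoprimeCyclic.lean`). Namespace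
`Literature.NumberTheory.EllipticCurves.QuadOrderTower`. THEOREMS ONLY (no definition, no named
fact, no `sorry`, no instance).

For a quadratic field `K` with integral basis `(1, ω)`, `ω² = m + tω`, and a prime `ℓ` with `ℓ𝓞_K`
prime (`ℓ` inert, residue field `𝔽_λ = 𝓞_K/ℓ𝓞_K` of order `ℓ²`):

* §1 the residue ring `𝓞_K/ℓ𝓞_K` is a domain of characteristic `ℓ`; integers are fixed by
  `x ↦ x^ℓ`; an element with `z^ℓ = z` is congruent to a rational integer (at most `ℓ` roots of
  `X^ℓ − X`), so `ω^ℓ ≠ ω`;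
* §2 **`Frob_ℓ = complex conjugation on 𝔽_λ`**: `ω^ℓ ≡ t − ω = ω̄`, hence
  `(X + Yω)^ℓ ≡ (X + tY) − Yω` and **`(X + Yω)^{ℓ+1} ≡ N(X + Yω) = X² + tXY − mY² (mod ℓ𝓞_K)`**
  (`mk_pow_eq_mk_conj`, `pow_succ_sub_norm_mem_span`) — the fact behind Gross's
  "`G_ℓ ≃ 𝔽_λ^×/𝔽_ℓ^×`" and "`Frob(λ_m)` … `ℓ` inert" in §3;
* §3 **every kernel unit satisfies `𝔞_v^{ℓ+1} = 1`** (`𝔞_v^{ℓ+1} = 𝔞_{v^{ℓ+1}} = 𝔞_{N(v)} = 𝒪_d`,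
  `kerUnitOf_pow_succ_eq_one`), so **every class in `ker(Pic(𝒪_{cℓ}) → Pic(𝒪_c))` has order
  dividing `ℓ + 1`** for `ℓ ∤ c` (`pow_succ_eq_one_of_picRes_eq_one`, `orderOf_dvd_succ_of_picRes_eq_one`)
  and the (cyclic) kernel has order dividing `ℓ + 1` (`natCard_ker_picRes_dvd_succ`) — Cox's exact
  sequence (7.25)/(7.27): the kernel is a quotient of `(𝓞_K/ℓ)^×/(ℤ/ℓ)^× ≅ 𝔽_{ℓ²}^×/𝔽_ℓ^×`, with
  equality `#ker = ℓ + 1` exactly when `𝒪_c^× = {±1}` (`QuadOrderPicardCoprimeCyclic.orderOf_eq_of_generator`).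

## References
* [GrossLMS1991] B. H. Gross, *Kolyvagin's work on modular elliptic curves*, LMS Lecture Notes 153
  (1991), §3 (held `book:editornd-l-functions-arithmetic`, p0217).
* [Cox2013] D. A. Cox, *Primes of the form x² + ny²*, 2nd ed. (2013), §7.D Thm. 7.24, (7.25)–(7.27),
  Prop. 5.16 (inert primes) (held `book:cox2013-primes-form-i-x-sup-2-sup`, p0159–p0161).
-/

noncomputable section

open scoped nonZeroDivisors
open NumberField Module Polynomial
open Literature.NumberTheory.QuadraticFields.Quadratic

namespace Literature.NumberTheory.EllipticCurves

namespace QuadOrderTower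

universe u

variable {K : Type u} [Field K]

/-! ### §1 The residue ring `𝓞_K/ℓ𝓞_K` at an inert prime -/

section Residue

variable (b : Basis (Fin 2) ℤ (𝓞 K)) (hb : b 0 = 1) {ℓ : ℕ} [hp : Fact ℓ.Prime]

/-- `𝓞_K/ℓ𝓞_K` has characteristic `ℓ` (`ℓ𝓞_K ≠ 𝓞_K`). [cite: Cox2013, §7.D (7.27) (𝒪_K/ℓ𝒪_K)] -/
theorem charP_quot_span (hℓP : (Ideal.span {(ℓ : 𝓞 K)}).IsPrime) :
    CharP (𝓞 K ⧸ Ideal.span {(ℓ : 𝓞 K)}) ℓ := by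
  haveI : IsDomain (𝓞 K ⧸ Ideal.span {(ℓ : 𝓞 K)}) := (Ideal.Quotient.isDomain_iff_prime _).mpr hℓP
  refine (CharP.charP_iff_prime_eq_zero hp.out).mpr ?_
  rw [← map_natCast (Ideal.Quotient.mk (Ideal.span {(ℓ : 𝓞 K)})), Ideal.Quotient.eq_zero_iff_mem]
  exact Ideal.mem_span_singleton_self _

/-- Integers are fixed by the `ℓ`-th power map on `𝓞_K/ℓ𝓞_K` (Fermat). [cite: Cox2013, §7.D (7.27) ((ℤ/ℓ)^× ⊆ (𝒪_K/ℓ)^×)] -/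
theorem intCast_pow_eq_intCast (hℓP : (Ideal.span {(ℓ : 𝓞 K)}).IsPrime) (k : ℤ) :
    ((k : 𝓞 K ⧸ Ideal.span {(ℓ : 𝓞 K)})) ^ ℓ = k := by
  haveI := charP_quot_span (K := K) hℓP
  have h := congrArg (ZMod.castHom (dvd_refl ℓ) (𝓞 K ⧸ Ideal.span {(ℓ : 𝓞 K)})) (ZMod.pow_card (k : ZMod ℓ))
  rwa [map_pow, map_intCast] at h

omit hp in
include hb in
/-- Coordinates of an element of `ℓ𝓞_K` are divisible by `ℓ`: if `U + Vω ∈ ℓ𝓞_K` then `ℓ ∣ U` and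
`ℓ ∣ V`. [cite: Cox2013, §7.A Lemma 7.2 (𝓞_K = [1, ω])] -/
theorem dvd_coords_of_mem_span {U V : ℤ} (h : (U : 𝓞 K) + (V : 𝓞 K) * b 1 ∈ Ideal.span {(ℓ : 𝓞 K)}) :
    (ℓ : ℤ) ∣ U ∧ (ℓ : ℤ) ∣ V := by
  obtain ⟨w, hw⟩ := Ideal.mem_span_singleton'.mp h
  have hcoords : ∀ i : Fin 2, b.repr ((U : 𝓞 K) + (V : 𝓞 K) * b 1) i = if i = 0 then U else V := by
    intro i
    have e : (U : 𝓞 K) + (V : 𝓞 K) * b 1 = U • b 0 + V • b 1 := by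
      rw [hb, zsmul_eq_mul, zsmul_eq_mul, mul_one]
    rw [e, map_add, map_zsmul, map_zsmul, b.repr_self, b.repr_self]
    fin_cases i <;> simp
  have hrepr : ∀ i : Fin 2, (if i = 0 then U else V) = (ℓ : ℤ) * b.repr w i := fun i => by
    rw [← hcoords i, ← hw, mul_comm, ← nsmul_eq_mul, map_nsmul, Finsupp.smul_apply, nsmul_eq_mul]
  exact ⟨⟨b.repr w 0, by simpa using hrepr 0⟩, ⟨b.repr w 1, by simpa using hrepr 1⟩⟩

/-- **An element of `𝓞_K/ℓ𝓞_K` fixed by the `ℓ`-th power map is a rational integer mod `ℓ`**: the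
`ℓ` integers `0, …, ℓ − 1` are already `ℓ` distinct roots of `X^ℓ − X` in the domain `𝓞_K/ℓ𝓞_K`.
[cite: Cox2013, §7.D (7.27) ((𝒪_K/ℓ)^× versus (ℤ/ℓ)^×)] -/
theorem exists_sub_intCast_mem_of_pow_eq (hℓP : (Ideal.span {(ℓ : 𝓞 K)}).IsPrime) {z : 𝓞 K}
    (hz : (Ideal.Quotient.mk (Ideal.span {(ℓ : 𝓞 K)}) z) ^ ℓ = Ideal.Quotient.mk (Ideal.span {(ℓ : 𝓞 K)}) z) :
    ∃ k : ℤ, z - k ∈ Ideal.span {(ℓ : 𝓞 K)} := by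
  classical
  set I : Ideal (𝓞 K) := Ideal.span {(ℓ : 𝓞 K)} with hI
  set R := 𝓞 K ⧸ I
  haveI : IsDomain R := (Ideal.Quotient.isDomain_iff_prime I).mpr hℓP
  haveI := charP_quot_span (K := K) hℓP
  by_cases hex : ∃ k : ℤ, z - k ∈ Ideal.span {(ℓ : 𝓞 K)}
  · exact hex
  exfalso
  have hcon : ∀ k : ℤ, z - k ∉ I := fun k hk => hex ⟨k, hk⟩
  -- the polynomial `X^ℓ - X` over the domain `R` and `ℓ + 1` distinct roots
  set P : R[X] := X ^ ℓ - X with hP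
  have hdeg : P.natDegree = ℓ := by
    rw [hP, natDegree_sub_eq_left_of_natDegree_lt] <;> rw [natDegree_X_pow]
    rw [natDegree_X]; exact hp.out.one_lt
  have hP0 : P ≠ 0 := fun h0 => hp.out.ne_zero (by rw [← hdeg, h0, natDegree_zero])
  let S : Finset R := insert (Ideal.Quotient.mk I z) ((Finset.range ℓ).image fun k : ℕ => (k : R))
  have hroots : ∀ x ∈ S, x ∈ P.roots := by
    intro x hx
    rw [mem_roots hP0, IsRoot, hP, eval_sub, eval_pow, eval_X, sub_eq_zero]
    rcases Finset.mem_insert.mp hx with rfl | hx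
    · exact hz
    · obtain ⟨k, -, rfl⟩ := Finset.mem_image.mp hx
      exact_mod_cast intCast_pow_eq_intCast (K := K) hℓP k
  have hcard : S.card = ℓ + 1 := by
    rw [Finset.card_insert_of_notMem, Finset.card_image_of_injOn, Finset.card_range]
    · intro k₁ hk₁ k₂ hk₂ he
      have h12 := (CharP.natCast_eq_natCast R ℓ).mp he
      rw [Nat.ModEq, Nat.mod_eq_of_lt (Finset.mem_range.mp hk₁),
        Nat.mod_eq_of_lt (Finset.mem_range.mp hk₂)] at h12
      exact h12
    · intro hmem
      obtain ⟨k, -, hk⟩ := Finset.mem_image.mp hmem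
      refine hcon (k : ℤ) ?_
      rw [← Ideal.Quotient.eq, ← hk, map_intCast, Int.cast_natCast]
  have hle : S.card ≤ ℓ := by
    calc S.card ≤ P.roots.toFinset.card :=
          Finset.card_le_card fun x hx => Multiset.mem_toFinset.mpr (hroots x hx)
      _ ≤ P.roots.card := Multiset.toFinset_card_le _
      _ ≤ P.natDegree := card_roots' P
      _ = ℓ := hdeg
  omega

include hb in
/-- **`ω^ℓ ≢ ω (mod ℓ𝓞_K)`**: otherwise `ω ≡ k ∈ ℤ`, and the `ω`-coordinate of `ω − k` is `1`,
not divisible by `ℓ`. [cite: Cox2013, §7.D (7.27) (𝒪_K/ℓ𝒪_K ≠ ℤ/ℓ), §5.B Prop. 5.16] -/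
theorem mk_basis_pow_ne (hℓP : (Ideal.span {(ℓ : 𝓞 K)}).IsPrime) :
    (Ideal.Quotient.mk (Ideal.span {(ℓ : 𝓞 K)}) (b 1)) ^ ℓ ≠
      Ideal.Quotient.mk (Ideal.span {(ℓ : 𝓞 K)}) (b 1) := by
  intro h
  obtain ⟨k, hk⟩ := exists_sub_intCast_mem_of_pow_eq hℓP h
  have h' : ((-k : ℤ) : 𝓞 K) + ((1 : ℤ) : 𝓞 K) * b 1 ∈ Ideal.span {(ℓ : 𝓞 K)} := by
    have e : ((-k : ℤ) : 𝓞 K) + ((1 : ℤ) : 𝓞 K) * b 1 = b 1 - k := by push_cast; ring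
    rw [e]; exact hk
  have h1 := (dvd_coords_of_mem_span b hb h').2
  exact hp.out.ne_one (by exact_mod_cast Int.eq_one_of_dvd_one (by positivity) h1)

end Residue

/-! ### §2 Frobenius is complex conjugation on `𝓞_K/ℓ𝓞_K` for `ℓ` inert -/

section Frobenius

variable (b : Basis (Fin 2) ℤ (𝓞 K)) (hb : b 0 = 1) {ℓ : ℕ} [hp : Fact ℓ.Prime]

include hb in
/-- **`ω^ℓ ≡ ω̄ = t − ω (mod ℓ𝓞_K)` for `ℓ` inert**: `ω^ℓ` is again a root of `x² − tx − m` in the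
domain `𝓞_K/ℓ𝓞_K` (Frobenius fixes the integer coefficients), so `ω^ℓ ∈ {ω, t − ω}`, and
`ω^ℓ ≠ ω` (`mk_basis_pow_ne`). [cite: GrossLMS1991, §3 (ℓ inert: Frob_ℓ = τ on 𝔽_λ)] [cite: Cox2013, §7.D (7.27), §5.B Prop. 5.16] -/
theorem mk_basis_pow_eq (hℓP : (Ideal.span {(ℓ : 𝓞 K)}).IsPrime) :
    (Ideal.Quotient.mk (Ideal.span {(ℓ : 𝓞 K)}) (b 1)) ^ ℓ =
      Ideal.Quotient.mk (Ideal.span {(ℓ : 𝓞 K)}) ((tConst b : 𝓞 K) - b 1) := by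
  set I : Ideal (𝓞 K) := Ideal.span {(ℓ : 𝓞 K)} with hI
  haveI : IsDomain (𝓞 K ⧸ I) := (Ideal.Quotient.isDomain_iff_prime I).mpr hℓP
  haveI := charP_quot_span (K := K) hℓP
  set w := Ideal.Quotient.mk I (b 1) with hw
  have hω : w * w = (mConst b : 𝓞 K ⧸ I) + (tConst b : 𝓞 K ⧸ I) * w := by
    have e := congrArg (Ideal.Quotient.mk I) (basis_one_mul_self_eq b hb)
    simp only [map_mul, map_add, map_intCast] at e
    exact e
  -- `a := w^ℓ` satisfies the same quadratic equation
  have ha : w ^ ℓ * w ^ ℓ = (mConst b : 𝓞 K ⧸ I) + (tConst b : 𝓞 K ⧸ I) * w ^ ℓ := by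
    have e : (w * w) ^ ℓ = ((mConst b : 𝓞 K ⧸ I) + (tConst b : 𝓞 K ⧸ I) * w) ^ ℓ := by rw [hω]
    rw [mul_pow] at e
    rw [e, add_pow_char, mul_pow, intCast_pow_eq_intCast (K := K) hℓP,
      intCast_pow_eq_intCast (K := K) hℓP]
  have hprod : (w ^ ℓ - w) * (w ^ ℓ - ((tConst b : 𝓞 K ⧸ I) - w)) = 0 := by
    linear_combination ha - hω
  rcases mul_eq_zero.mp hprod with h1 | h1
  · exact absurd (sub_eq_zero.mp h1) (mk_basis_pow_ne b hb hℓP)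
  · rw [sub_eq_zero] at h1
    rw [h1, map_sub, map_intCast]

include hb in
/-- **`(X + Yω)^ℓ ≡ X̄ + Yω̄ = (X + tY) − Yω (mod ℓ𝓞_K)`**: Frobenius at the inert prime `ℓ` is
complex conjugation on `𝔽_λ = 𝓞_K/ℓ𝓞_K`. [cite: GrossLMS1991, §3 (ℓ inert: Frob_ℓ = τ)] [cite: Cox2013, §7.D (7.27)] -/
theorem mk_pow_eq_mk_conj (hℓP : (Ideal.span {(ℓ : 𝓞 K)}).IsPrime) (X Y : ℤ) :
    (Ideal.Quotient.mk (Ideal.span {(ℓ : 𝓞 K)}) ((X : 𝓞 K) + (Y : 𝓞 K) * b 1)) ^ ℓ =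
      Ideal.Quotient.mk (Ideal.span {(ℓ : 𝓞 K)})
        (((X + tConst b * Y : ℤ) : 𝓞 K) + ((-Y : ℤ) : 𝓞 K) * b 1) := by
  haveI := charP_quot_span (K := K) hℓP
  rw [map_add, map_mul, map_intCast, map_intCast, add_pow_char, mul_pow,
    intCast_pow_eq_intCast (K := K) hℓP, intCast_pow_eq_intCast (K := K) hℓP, mk_basis_pow_eq b hb hℓP]
  simp only [map_add, map_mul, map_sub, map_intCast]
  push_cast
  ring

include hb in
/-- **`(X + Yω)^{ℓ+1} ≡ N(X + Yω) = X² + tXY − mY² (mod ℓ𝓞_K)`** for `ℓ` inert: `u^{ℓ+1} = u^ℓ·u ≡ ū u`.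
This is the identity behind `G_ℓ ≃ 𝔽_λ^×/𝔽_ℓ^×` having order `ℓ + 1`. [cite: GrossLMS1991, §3 (G_ℓ ≃ 𝔽_λ^×/𝔽_ℓ^×)] [cite: Cox2013, §7.D (7.27)] -/
theorem pow_succ_sub_norm_mem_span (hℓP : (Ideal.span {(ℓ : 𝓞 K)}).IsPrime) (X Y : ℤ) :
    ((X : 𝓞 K) + (Y : 𝓞 K) * b 1) ^ (ℓ + 1) -
      ((X ^ 2 + tConst b * X * Y - mConst b * Y ^ 2 : ℤ) : 𝓞 K) ∈ Ideal.span {(ℓ : 𝓞 K)} := by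
  rw [← Ideal.Quotient.eq, map_pow, pow_succ, mk_pow_eq_mk_conj b hb hℓP, ← map_mul, mul_comm,
    coords_mul_conj_ringOfIntegers b hb X Y]

end Frobenius

/-! ### §3 The kernel of `Pic(𝒪_{cℓ}) → Pic(𝒪_c)` has exponent dividing `ℓ + 1` -/

section Exponent

variable [NumberField K] {c d : ℕ} [NeZero d] (b : Basis (Fin 2) ℤ (𝓞 K)) (hb : b 0 = 1) {ℓ : ℕ} [hp : Fact ℓ.Prime]

omit hp in
/-- **`𝔞_n = 𝒪_d` for an integer `n` prime to `ℓ`** (`an + bℓ = 1`: `𝔞_1 ⊆ 𝔞_n ⊆ 𝔞_1 = 𝒪_d` by the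
scaling lemma `kerFrac_sub_one_le_of_eq`). [cite: Cox2013, §7.D Thm. 7.24, (7.27) ((ℤ/ℓ)^× ↦ 1)] -/
theorem kerFrac_intCast_sub_one_eq_one (hd : d = c * ℓ) {n : ℤ} (hn : IsCoprime n ℓ) :
    kerFrac (Dvd.intro ℓ hd.symm) ℓ ((n : K) - 1) = 1 := by
  obtain ⟨a, q, haq⟩ := hn
  have haq' : (a : K) * n + (ℓ : K) * q = 1 := by
    have e := congrArg (fun z : ℤ => (z : K)) haq
    push_cast at e
    linear_combination e
  rw [← kerFrac_one_sub_one_eq_one (K := K) hd]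
  apply le_antisymm
  · exact kerFrac_sub_one_le_of_eq (Dvd.intro ℓ hd.symm) (a := n) (Subalgebra.zero_mem _)
      (by rw [mul_one, mul_zero, add_zero])
  · exact kerFrac_sub_one_le_of_eq (Dvd.intro ℓ hd.symm) (a := a) (Subalgebra.intCast_mem _ q)
      haq'.symm

include hb in
/-- **`𝔞_v^{ℓ+1} = 1` for every kernel unit `𝔞_v`, `v = X + Yω ∈ 𝒪_c` of norm prime to `ℓ`**
(`ℓ ∤ c` inert, `d = cℓ`): `𝔞_v^{ℓ+1} = 𝔞_{v^{ℓ+1}}` (`coe_kerUnitOf_pow`), `v^{ℓ+1} ≡ N(v) (mod ℓ𝓞_K)`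
inside `𝒪_c` (`pow_succ_sub_norm_mem_span`, `kerFrac_sub_one_eq_of_sub_mem_span`), and
`𝔞_{N(v)} = 𝒪_d`. No hypothesis on the units of `𝒪_c`. [cite: Cox2013, §7.D Thm. 7.24 (7.25)–(7.27)] [cite: GrossLMS1991, §3 (G_ℓ ≃ 𝔽_λ^×/𝔽_ℓ^×)] -/
theorem kerUnitOf_pow_succ_eq_one (hd : d = c * ℓ) (hℓc : ¬ ℓ ∣ c)
    (hℓP : (Ideal.span {(ℓ : 𝓞 K)}).IsPrime) {X Y : ℤ} (hY : (c : ℤ) ∣ Y)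
    (hn : IsCoprime (X ^ 2 + tConst b * X * Y - mConst b * Y ^ 2) ℓ) :
    kerUnitOf hd (coords_mem_quadOrder b hb hY) (coords_mem_quadOrder b hb ((dvd_neg).mpr hY))
      (coords_mul_conj b hb X Y) hn ^ (ℓ + 1) = 1 := by
  refine Units.ext ?_
  rw [coe_kerUnitOf_pow, Units.val_one]
  have ev : ((X : K) + (Y : K) * omega b) = algebraMap (𝓞 K) K ((X : 𝓞 K) + (Y : 𝓞 K) * b 1) := by
    simp [omega]
  have en : ((X ^ 2 + tConst b * X * Y - mConst b * Y ^ 2 : ℤ) : K) =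
      algebraMap (𝓞 K) K ((X ^ 2 + tConst b * X * Y - mConst b * Y ^ 2 : ℤ) : 𝓞 K) := by
    rw [map_intCast]
  rw [ev, ← map_pow, kerFrac_sub_one_eq_of_sub_mem_span b hb (Dvd.intro ℓ hd.symm) hp.out hℓc
    (by rw [map_pow, ← ev]; exact Subalgebra.pow_mem _ (coords_mem_quadOrder b hb hY) _)
    (by rw [map_intCast]; exact Subalgebra.intCast_mem _ _) (pow_succ_sub_norm_mem_span b hb hℓP X Y),
    ← en, kerFrac_intCast_sub_one_eq_one hd hn]

variable [NeZero c]

/-- **Every class in `ker(Pic(𝒪_{cℓ}) → Pic(𝒪_c))` satisfies `τ^{ℓ+1} = 1`** (`K` quadratic, `ℓ ∤ c`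
prime with `ℓ𝓞_K` prime; NO hypothesis on units): every kernel class is `[𝔞_v]`
(`exists_coe_eq_kerFrac_sub_one`) and `𝔞_v^{ℓ+1} = 1`. Cox's exact sequence (7.25)/(7.27): the kernel is
a quotient of `(𝓞_K/ℓ)^×/(ℤ/ℓ)^× ≅ 𝔽_{ℓ²}^×/𝔽_ℓ^×`, cyclic of order `ℓ + 1`.
[cite: Cox2013, §7.D Thm. 7.24 (7.25)–(7.27)] [cite: GrossLMS1991, §3 (G_ℓ ≃ 𝔽_λ^×/𝔽_ℓ^× of order ℓ + 1)] -/
theorem pow_succ_eq_one_of_picRes_eq_one (h2 : Module.finrank ℚ K = 2) (hd : d = c * ℓ) (hℓc : ¬ ℓ ∣ c)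
    (hℓP : (Ideal.span {(ℓ : 𝓞 K)}).IsPrime) {τ : ClassGroup (quadOrder K d)}
    (hτ : picRes K (Dvd.intro ℓ hd.symm) τ = 1) : τ ^ (ℓ + 1) = 1 := by
  obtain ⟨b, hb⟩ := exists_basis_zero_eq_one (K := K) h2
  obtain ⟨𝔞, rfl, h1⟩ := exists_mk_eq_of_picRes_eq_one (K := K) (Dvd.intro ℓ hd.symm) hτ
  obtain ⟨X, Y, hY, hn, h𝔞⟩ := exists_coe_eq_kerFrac_sub_one b hb hd hℓc
    (anisotropic_of_span_natCast_isPrime b hb hℓP) 𝔞 h1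
  have he : 𝔞 = kerUnitOf hd (coords_mem_quadOrder b hb hY)
      (coords_mem_quadOrder b hb ((dvd_neg).mpr hY)) (coords_mul_conj b hb X Y) hn :=
    Units.ext (by rw [h𝔞, coe_kerUnitOf])
  rw [← map_pow, he, kerUnitOf_pow_succ_eq_one b hb hd hℓc hℓP hY hn, map_one]

/-- **The order of every kernel class divides `ℓ + 1`.** [cite: Cox2013, §7.D Thm. 7.24 (7.25)–(7.27)] -/
theorem orderOf_dvd_succ_of_picRes_eq_one (h2 : Module.finrank ℚ K = 2) (hd : d = c * ℓ)
    (hℓc : ¬ ℓ ∣ c) (hℓP : (Ideal.span {(ℓ : 𝓞 K)}).IsPrime) {τ : ClassGroup (quadOrder K d)}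
    (hτ : picRes K (Dvd.intro ℓ hd.symm) τ = 1) : orderOf τ ∣ ℓ + 1 :=
  orderOf_dvd_of_pow_eq_one (pow_succ_eq_one_of_picRes_eq_one h2 hd hℓc hℓP hτ)

/-- **`#ker(Pic(𝒪_{cℓ}) → Pic(𝒪_c)) ∣ ℓ + 1`** (`K` quadratic, `ℓ ∤ c` inert; no hypothesis on units):
the kernel is cyclic (`exists_generator_ker_picRes`) on a generator of order dividing `ℓ + 1`; it is
exactly `ℓ + 1` when `𝒪_c^× = {±1}` (`orderOf_eq_of_generator`), and `(ℓ + 1)/[𝒪_K^× : 𝒪^×]`-type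
otherwise (Cox Thm. 7.24). [cite: Cox2013, §7.D Thm. 7.24 (7.25)–(7.27)] -/
theorem natCard_ker_picRes_dvd_succ (h2 : Module.finrank ℚ K = 2) (hd : d = c * ℓ) (hℓc : ¬ ℓ ∣ c)
    (hℓP : (Ideal.span {(ℓ : 𝓞 K)}).IsPrime) :
    Nat.card (picRes K (Dvd.intro ℓ hd.symm)).ker ∣ ℓ + 1 := by
  obtain ⟨σ, hσ, hgen⟩ := exists_generator_ker_picRes (K := K) h2 hd hℓc hℓP
  have hker : (picRes K (Dvd.intro ℓ hd.symm)).ker = Subgroup.zpowers σ :=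
    le_antisymm (fun τ hτ => hgen τ hτ) (Subgroup.zpowers_le.mpr hσ)
  rw [hker, Nat.card_zpowers]
  exact orderOf_dvd_succ_of_picRes_eq_one h2 hd hℓc hℓP hσ

end Exponent

end QuadOrderTower

end Literature.NumberTheory.EllipticCurves
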